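import Summits.QuantumFields.YangMills.Theses.BackwardLiouvilleRigidity

/-!
# Route `BackwardLiouvilleRigidity` — THE TOP-HEIGHT (ZERO-STEP) INSTANCE OF THE DECIDING CRUX `BackwardStabilityAdmFR`, and
# «the four-point clause contains the one-bond clause»

Two kernel remarks for the line-writer of stmt-QuantumFields-28294 (`BackwardStabilityAdmFR`, deciding) ∕ 28295 ∕ 28296 (director-ym R606
ORDER (1); tribunal J r8: «Rung J would accept … an instance of BackwardStabilityAdmFR»), companions of the frame package
`…AdmFRFrameInhabited` ∕ `…FloorTail` ∕ `…EmptyClass`: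

* §1 `abs_sub_le_of_fourPoint` — THE DEGENERATE RECTANGLE: in the clustered four-point clause of the tower hypotheses
  (`|(D U − D V) − (D W − D Z)| ≤ ω·exp(−κ·tdist(b, b'))` for window configurations `U, V` agreeing off `b`, `U, W` and `V, Z` agreeing
  off `b'`, `W, Z` agreeing off `b`), the choice `b' := b`, `W := Z := U` is admissible and `tdist(b, b) = 0`, so the clause CONTAINS the
  one-bond oscillation bound `|D U − D V| ≤ ω` at the same height (generic: any `Params`, level, group, window predicate, `D`).  Consequences
  for the typings: the one-bond `ω_j` clause of `UVClassRigidity.UVRigidity` is implied by its two-bond clause; the merging rate `ω_J` that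
  `ClassLimitTrajectoriesAdmFR` must deliver dominates the one-bond oscillation of `log ρ_J − log ρ'_J` on the window.
* §2 `backwardStabilityAdmFR_topHeight` — THE ZERO-STEP INSTANCE: the statement of `BackwardStabilityAdmFR` with its conclusion
  `∀ (j J : ℕ), j₁ ≤ j → j ≤ J → …` restricted to the diagonal `j = J` HOLDS, for every admissible pair of towers, with
  `θ := 1, C := 0, w₀ := 1, ε := 0, δ := 0, j₁ := j₀`: by §1 the window oscillation at height `J` is `≤ ω_J ≤ e·ω_J·(1 + 2β_J·#Plaq_J)`.
* §3 `backwardStabilityAdmFR_of_omega_ge` — SCOPING: with the hypothesis `∃ m > 0, ∀ j, m ≤ ω j` inserted the crux holds VACUOUSLY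
  (`w₀ := m` makes the first side condition `e·ω_J ≤ m` void) — the constants are chosen after the pair, so the crux speaks only about
  pairs with `inf_J ω_J = 0`.  §4: the crux implies both (`topHeight_of_…`: `j := J`; `omega_ge_of_…`: drop the hypothesis), so §2–§3 are
  literally instances of it.

HONEST SCOPE.  The backward steps `j < J` — propagating the top-height input `ω_J` DOWN the tower through the floor-class tails — are the
organ's whole content (`OneStepBackwardContractionAdmFR` chained by ✓`BackwardChainLemmaAdmFR`) and are NOT touched; nothing of
28294∕28295∕28296 is proved; rung R3 (`YM3TorusSU2`, finite-volume SU(2) YM₃ on T³) and every summit statement stay OPEN; the Yang–Mills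
mass gap is NOT proved.
-/

namespace Summit.QuantumFields.YangMills.Theorems.AdmFRTopHeight

open Filter Topology MeasureTheory
open Literature.MathematicalPhysics.QuantumFieldTheory.Balaban1983to89 T3ContinuumYM3Torus T3UnitScaleTilt

/-! ## §1 The degenerate rectangle: the four-point clause contains the one-bond clause -/

/-- **THE FOUR-POINT CLAUSE CONTAINS THE ONE-BOND CLAUSE** (degenerate rectangle `b' := b`, `W := Z := U`; `tdist(b.src, b.src) = 0`): for any
function `D` on level-`j` configurations, any window predicate `S` and any `ω, κ`, the clustered second-difference bound implies
`|D U − D V| ≤ ω` for window configurations agreeing off one bond. [cite: Balaban1985UV3, (25) p.262] -/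
theorem abs_sub_le_of_fourPoint {P : Params} {j : ℕ} {G : Type*} {D : GaugeField P j G → ℝ} {S : GaugeField P j G → Prop} {ω κ : ℝ}
    (h4 : ∀ (b b' : PBond P j) (U V W Z : GaugeField P j G), S U → S V → S W → S Z → (∀ e, e ≠ b → U e = V e) →
      (∀ e, e ≠ b' → U e = W e) → (∀ e, e ≠ b' → V e = Z e) → (∀ e, e ≠ b → W e = Z e) →
      |(D U - D V) - (D W - D Z)| ≤ ω * Real.exp (-(κ * (b.src.tdist b'.src : ℝ))))
    (b : PBond P j) (U V : GaugeField P j G) (hU : S U) (hV : S V) (hUV : ∀ e, e ≠ b → U e = V e) : |D U - D V| ≤ ω := by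
  have h := h4 b b U V U U hU hV hU hU hUV (fun _ _ => rfl) (fun e he => (hUV e he).symm) (fun _ _ => rfl)
  have h0 : (b.src.tdist b.src : ℝ) = 0 := by
    have : b.src.tdist b.src = 0 := by simp [Site.tdist]
    exact_mod_cast this
  rw [h0, mul_zero, neg_zero, Real.exp_zero, mul_one, sub_self, sub_zero] at h
  exact h

/-! ## §2 The top-height (zero-step) instance of `BackwardStabilityAdmFR` -/

/-- **`BackwardStabilityAdmFR` ON THE DIAGONAL `j = J` HOLDS**: the deciding crux's statement (stmt-QuantumFields-28294, route file
`Theses/BackwardLiouvilleRigidity.lean`, rev 19∕20) with the conclusion's `∀ (j J : ℕ), j₁ ≤ j → j ≤ J →` replaced by `∀ (J : ℕ), j₁ ≤ J →`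
(and `j ↦ J` in its body), everything else VERBATIM — proved with `θ := 1, C := 0, w₀ := 1, ε := 0, δ := 0, j₁ := j₀`: the four-point clause
of the tower hypotheses at height `J` gives the one-bond oscillation `≤ ω_J` (`abs_sub_le_of_fourPoint`), and
`ω_J ≤ exp(0 + 1)·(1·ω_J + 0)·(1∕1 + 2β_J·#Plaq_J)`.  The backward steps `j < J` are the organ's content, untouched.
[cite: Balaban1985UV3, (25) p.262, (41)-(47) pp.266-267] -/
theorem backwardStabilityAdmFR_topHeight : open MeasureTheory Filter Topology Literature.MathematicalPhysics.QuantumFieldTheory.Balaban1983to89 T3ContinuumYM3Torus T3NestedUnitLaws T3UnitLawDensityEML T4Continuum BalabanUVClass T3UnitScaleTilt in ∃ γ₁ : ℝ, 0 < γ₁ ∧ ∀ (F : T3Family) (γ : ℝ), 0 < γ → γ ≤ γ₁ → ∀ (b₀ p₀ κ : ℝ) (j₀ : ℕ) (prm : ℕ → ClassParams) (ω η : ℕ → ℝ), 0 < b₀ → 0 < p₀ → AdmissibleClassParams F γ b₀ p₀ prm → 0 < κ → (∀ j, 0 ≤ ω j ∧ 0 ≤ η j) → Summable η → Summable (fun i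 => ∑' k, η (k + i)) → Tendsto (fun j => (∑' k, η (k + j)) * ((1 + 2 * ((F.L : ℝ) ^ j / γ) * (Fintype.card (Plaq (F.P j) 0) : ℝ)) * (Fintype.card (PBond (F.P j) 0) : ℝ) ^ 2)) atTop (𝓝 0) → ∀ (μ μ' : ((j : ℕ) → MeasureTheory.Measure (GaugeField (F.P j) 0 ↥(Matrix.specialUnitaryGroup (Fin 2) ℂ)))) (ρ ρ' : ((j : ℕ) → GaugeField (F.P j) 0 ↥(Matrix.specialUnitaryGroup (Fin 2) ℂ) → ℝ)), (∀ j : ℕ, IsProbabilityMeasure (μ j) ∧ μ j = Measure.map (descend F ℰp j) (μ (j + 1))) → (∀ j : ℕ, IsProbabilityMeasure (μ' j) ∧ μ' j = Measure.map (descend F ℰp j) (μ' (j + 1))) → (∀ j : ℕ, j₀ ≤ j → ((∀ U, PlaqSmall (θBal F.L γ b₀ p₀ j) U → 0 < ρ j U ∧ 0 < ρ' j U) ∧ μ j = (fieldMeasure _ _ _).withDensity (fun U => ENNReal.ofReal (ρ j U)) ∧ μ' j = (fieldMeasure _ _ _).withDensity (fun U => ENNReal.ofReal (ρ' j U)) ∧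 (∃ κ : ℝ, MemAtHeight F ℰp j (prm j) (fun U => Real.exp κ * ρ j U)) ∧ (∃ κ : ℝ, MemAtHeight F ℰp j (prm j) (fun U => Real.exp κ * ρ' j U)) ∧ (∀ (b b' : PBond (F.P j) 0) U V W Z, PlaqSmall (θBal F.L γ b₀ p₀ j) U → PlaqSmall (θBal F.L γ b₀ p₀ j) V → PlaqSmall (θBal F.L γ b₀ p₀ j) W → PlaqSmall (θBal F.L γ b₀ p₀ j) Z → (∀ e, e ≠ b → U e = V e) → (∀ e, e ≠ b' → U e = W e) → (∀ e, e ≠ b' → V e = Z e) → (∀ e, e ≠ b → W e = Z e) → |(Real.log (ρ j U) - Real.log (ρ' j U)) - (Real.log (ρ j V) - Real.log (ρ' j V)) - ((Real.log (ρ j W) - Real.log (ρ' j W)) - (Real.log (ρ j Z) - Real.log (ρ' j Z)))| ≤ ω j * Real.exp (-(κ * (b.src.tdist b'.src : ℝ)))) ∧ μ j {U | ¬ PlaqSmall (θBal F.L γ b₀ p₀ j) U} ≤ ENNReal.ofReal (η j) ∧ μ' j {U | ¬ PlaqSmall (θBal F.L γ b₀ p₀ j) U} ≤ ENNReal.ofReal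 (η j) ∧ (ContinuousOn (ρ j) {U | PlaqSmall (θBal F.L γ b₀ p₀ j) U} ∧ ContinuousOn (ρ' j) {U | PlaqSmall (θBal F.L γ b₀ p₀ j) U}))) → ∃ (θ C w₀ : ℝ) (ε δ : ℕ → ℝ) (j₁ : ℕ), 0 < θ ∧ 0 ≤ C ∧ 0 < w₀ ∧ (∀ j, 0 ≤ ε j ∧ 0 ≤ δ j) ∧ Summable ε ∧ Summable δ ∧ Summable (fun i => ∑' k, δ (k + i)) ∧ Tendsto (fun j => (∑' k, δ (k + j)) * ((1 + 2 * ((F.L : ℝ) ^ j / γ) * (Fintype.card (Plaq (F.P j) 0) : ℝ)) * (Fintype.card (PBond (F.P j) 0) : ℝ) ^ 2)) atTop (𝓝 0) ∧ j₀ ≤ j₁ ∧ ∀ (J : ℕ), j₁ ≤ J → Real.exp (∑' k, ε k + 1) * (θ * ω J + (∑' k, δ (k + J))) ≤ w₀ → C * (Real.exp (∑' k, ε k + 1) * ((J : ℝ) * (θ * ω J) + (∑' i, ∑' k, δ (k + (i + J))))) ≤ 1 → ∀ (b : PBond (F.P J) 0) U V, PlaqSmall (θBal F.L γ b₀ p₀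 J) U → PlaqSmall (θBal F.L γ b₀ p₀ J) V → (∀ e, e ≠ b → U e = V e) → |(Real.log (ρ J U) - Real.log (ρ' J U)) - (Real.log (ρ J V) - Real.log (ρ' J V))| ≤ Real.exp (∑' k, ε k + 1) * (θ * ω J + (∑' k, δ (k + J))) * (1 / θ + 2 * ((F.L : ℝ) ^ J / γ) * (Fintype.card (Plaq (F.P J) 0) : ℝ)) := by
  refine ⟨1, one_pos, ?_⟩
  intro F γ hγ hγ1 b₀ p₀ κ j₀ prm ω η hb₀ hp₀ hprm hκ hωη hη hηt hηf μ μ' ρ ρ' hμ hμ' hB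
  refine ⟨1, 0, 1, fun _ => 0, fun _ => 0, j₀, one_pos, le_rfl, one_pos, fun _ => ⟨le_rfl, le_rfl⟩, summable_zero, summable_zero,
    ?_, ?_, le_rfl, ?_⟩
  · simp [summable_zero]
  · simp
  · intro J hJ _ _ b U V hU hV hUV
    obtain ⟨-, -, -, -, -, h4, -, -, -⟩ := hB J hJ
    have hosc : |(Real.log (ρ J U) - Real.log (ρ' J U)) - (Real.log (ρ J V) - Real.log (ρ' J V))| ≤ ω J :=
      abs_sub_le_of_fourPoint (D := fun X => Real.log (ρ J X) - Real.log (ρ' J X)) (S := PlaqSmall (θBal F.L γ b₀ p₀ J))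
        (h4 := fun b b' U V W Z hU hV hW hZ h1 h2 h3 h4' => h4 b b' U V W Z hU hV hW hZ h1 h2 h3 h4') b U V hU hV hUV
    refine hosc.trans ?_
    have hω : 0 ≤ ω J := (hωη J).1
    have hL : (0 : ℝ) < F.L := by exact_mod_cast lt_trans zero_lt_one F.hL.2
    have hβ : 0 ≤ 2 * ((F.L : ℝ) ^ J / γ) * (Fintype.card (Plaq (F.P J) 0) : ℝ) :=
      mul_nonneg (mul_nonneg zero_le_two (div_nonneg (pow_nonneg hL.le J) hγ.le)) (Nat.cast_nonneg _)
    have he : (1 : ℝ) ≤ Real.exp (∑' k : ℕ, (fun _ : ℕ => (0 : ℝ)) k + 1) := by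
      simp
    have h1 : ω J ≤ ω J * (1 / 1 + 2 * ((F.L : ℝ) ^ J / γ) * (Fintype.card (Plaq (F.P J) 0) : ℝ)) := by
      have : (1 : ℝ) ≤ 1 / 1 + 2 * ((F.L : ℝ) ^ J / γ) * (Fintype.card (Plaq (F.P J) 0) : ℝ) := by linarith
      exact le_mul_of_one_le_right hω this
    calc ω J ≤ ω J * (1 / 1 + 2 * ((F.L : ℝ) ^ J / γ) * (Fintype.card (Plaq (F.P J) 0) : ℝ)) := h1
      _ = 1 * (1 * ω J + 0) * (1 / 1 + 2 * ((F.L : ℝ) ^ J / γ) * (Fintype.card (Plaq (F.P J) 0) : ℝ)) := by ring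
      _ ≤ Real.exp (∑' k : ℕ, (fun _ : ℕ => (0 : ℝ)) k + 1) * (1 * ω J + ∑' k : ℕ, (fun _ : ℕ => (0 : ℝ)) (k + J)) *
            (1 / 1 + 2 * ((F.L : ℝ) ^ J / γ) * (Fintype.card (Plaq (F.P J) 0) : ℝ)) := by
          simp only [tsum_zero, add_zero]
          gcongr
          · simp

/-! ## §3 Non-merging pairs: the side condition is void, the crux holds vacuously there -/

/-- **`BackwardStabilityAdmFR` RESTRICTED TO NON-MERGING PAIRS HOLDS VACUOUSLY**: the crux's statement (route l.179) with ONE hypothesis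
inserted after `(∀ j, 0 ≤ ω j ∧ 0 ≤ η j) →`, namely `(∃ m : ℝ, 0 < m ∧ ∀ j, m ≤ ω j) →` (the four-point rate stays away from `0`), everything
else VERBATIM incl. the full conclusion `∀ (j J : ℕ), j₁ ≤ j → j ≤ J → …`: with `θ := 1, C := 0, w₀ := m, ε := 0, δ := 0, j₁ := j₀` the first
smallness side condition `exp(Σε + 1)·(θ·ω_J + Σδ) ≤ w₀` reads `e·ω_J ≤ m`, impossible for `ω_J ≥ m > 0`.  READING (scoping remark): since
the constants `θ, C, w₀, ε, δ, j₁` are chosen AFTER the pair, the crux says nothing about pairs with `inf_J ω_J > 0`; its content lives on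
pairs with `inf_J ω_J = 0` (the assembly's regime `liminf J·ω_J = 0`) and, by §2, on the backward steps `j < J` only.
[cite: Balaban1985UV3, (41)-(47) pp.266-267] -/
theorem backwardStabilityAdmFR_of_omega_ge : open MeasureTheory Filter Topology Literature.MathematicalPhysics.QuantumFieldTheory.Balaban1983to89 T3ContinuumYM3Torus T3NestedUnitLaws T3UnitLawDensityEML T4Continuum BalabanUVClass T3UnitScaleTilt in ∃ γ₁ : ℝ, 0 < γ₁ ∧ ∀ (F : T3Family) (γ : ℝ), 0 < γ → γ ≤ γ₁ → ∀ (b₀ p₀ κ : ℝ) (j₀ : ℕ) (prm : ℕ → ClassParams) (ω η : ℕ → ℝ), 0 < b₀ → 0 < p₀ → AdmissibleClassParams F γ b₀ p₀ prm → 0 < κ → (∀ j, 0 ≤ ω j ∧ 0 ≤ η j) → (∃ m : ℝ, 0 < m ∧ ∀ j, m ≤ ω j) → Summable η → Summable (fun i => ∑' k, η (k + i)) → Tendsto (fun j => (∑' k, η (k + j)) * ((1 + 2 * ((F.L : ℝ) ^ j / γ) * (Fintype.card (Plaq (F.P j) 0) : ℝ)) * (Fintype.card (PBond (F.P j) 0)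 : ℝ) ^ 2)) atTop (𝓝 0) → ∀ (μ μ' : ((j : ℕ) → MeasureTheory.Measure (GaugeField (F.P j) 0 ↥(Matrix.specialUnitaryGroup (Fin 2) ℂ)))) (ρ ρ' : ((j : ℕ) → GaugeField (F.P j) 0 ↥(Matrix.specialUnitaryGroup (Fin 2) ℂ) → ℝ)), (∀ j : ℕ, IsProbabilityMeasure (μ j) ∧ μ j = Measure.map (descend F ℰp j) (μ (j + 1))) → (∀ j : ℕ, IsProbabilityMeasure (μ' j) ∧ μ' j = Measure.map (descend F ℰp j) (μ' (j + 1))) → (∀ j : ℕ, j₀ ≤ j → ((∀ U, PlaqSmall (θBal F.L γ b₀ p₀ j) U → 0 < ρ j U ∧ 0 < ρ' j U) ∧ μ j = (fieldMeasure _ _ _).withDensity (fun U => ENNReal.ofReal (ρ j U)) ∧ μ' j = (fieldMeasure _ _ _).withDensity (fun U => ENNReal.ofReal (ρ' j U)) ∧ (∃ κ : ℝ, MemAtHeight F ℰp j (prm j) (fun U => Real.exp κ * ρ j U)) ∧ (∃ κ : ℝ, MemAtHeight F ℰp j (prm j) (fun U => Real.exp κ * ρ' j U)) ∧ (∀ (b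 b' : PBond (F.P j) 0) U V W Z, PlaqSmall (θBal F.L γ b₀ p₀ j) U → PlaqSmall (θBal F.L γ b₀ p₀ j) V → PlaqSmall (θBal F.L γ b₀ p₀ j) W → PlaqSmall (θBal F.L γ b₀ p₀ j) Z → (∀ e, e ≠ b → U e = V e) → (∀ e, e ≠ b' → U e = W e) → (∀ e, e ≠ b' → V e = Z e) → (∀ e, e ≠ b → W e = Z e) → |(Real.log (ρ j U) - Real.log (ρ' j U)) - (Real.log (ρ j V) - Real.log (ρ' j V)) - ((Real.log (ρ j W) - Real.log (ρ' j W)) - (Real.log (ρ j Z) - Real.log (ρ' j Z)))| ≤ ω j * Real.exp (-(κ * (b.src.tdist b'.src : ℝ)))) ∧ μ j {U | ¬ PlaqSmall (θBal F.L γ b₀ p₀ j) U} ≤ ENNReal.ofReal (η j) ∧ μ' j {U | ¬ PlaqSmall (θBal F.L γ b₀ p₀ j) U} ≤ ENNReal.ofReal (η j) ∧ (ContinuousOn (ρ j) {U | PlaqSmall (θBal F.L γ b₀ p₀ j) U} ∧ ContinuousOn (ρ' j) {U | PlaqSmall (θBal F.L γ b₀ p₀ j) U}))) → ∃ (θ C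 w₀ : ℝ) (ε δ : ℕ → ℝ) (j₁ : ℕ), 0 < θ ∧ 0 ≤ C ∧ 0 < w₀ ∧ (∀ j, 0 ≤ ε j ∧ 0 ≤ δ j) ∧ Summable ε ∧ Summable δ ∧ Summable (fun i => ∑' k, δ (k + i)) ∧ Tendsto (fun j => (∑' k, δ (k + j)) * ((1 + 2 * ((F.L : ℝ) ^ j / γ) * (Fintype.card (Plaq (F.P j) 0) : ℝ)) * (Fintype.card (PBond (F.P j) 0) : ℝ) ^ 2)) atTop (𝓝 0) ∧ j₀ ≤ j₁ ∧ ∀ (j J : ℕ), j₁ ≤ j → j ≤ J → Real.exp (∑' k, ε k + 1) * (θ * ω J + (∑' k, δ (k + j))) ≤ w₀ → C * (Real.exp (∑' k, ε k + 1) * ((J : ℝ) * (θ * ω J) + (∑' i, ∑' k, δ (k + (i + j))))) ≤ 1 → ∀ (b : PBond (F.P j) 0) U V, PlaqSmall (θBal F.L γ b₀ p₀ j) U → PlaqSmall (θBal F.L γ b₀ p₀ j) V → (∀ e, e ≠ b → U e = V e) → |(Real.log (ρ j U) - Real.log (ρ' j U)) - (Real.log (ρ j V) - Real.log (ρ' j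 V))| ≤ Real.exp (∑' k, ε k + 1) * (θ * ω J + (∑' k, δ (k + j))) * (1 / θ + 2 * ((F.L : ℝ) ^ j / γ) * (Fintype.card (Plaq (F.P j) 0) : ℝ)) := by
  refine ⟨1, one_pos, ?_⟩
  intro F γ hγ hγ1 b₀ p₀ κ j₀ prm ω η hb₀ hp₀ hprm hκ hωη hm hη hηt hηf μ μ' ρ ρ' hμ hμ' hB
  obtain ⟨m, hm0, hmω⟩ := hm
  refine ⟨1, 0, m, fun _ => 0, fun _ => 0, j₀, one_pos, le_rfl, hm0, fun _ => ⟨le_rfl, le_rfl⟩, summable_zero, summable_zero,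
    ?_, ?_, le_rfl, ?_⟩
  · simp [summable_zero]
  · simp
  · intro j J _ _ hside _ b U V _ _ _
    exfalso
    have he : (1 : ℝ) + 1 ≤ Real.exp 1 := by
      have := Real.add_one_le_exp (1 : ℝ); linarith
    have hside' : Real.exp 1 * ω J ≤ m := by simpa [tsum_zero] using hside
    have hωJ := hmω J
    nlinarith

/-! ## §4 Both are literally instances of the crux -/

/-- `BackwardStabilityAdmFR` implies its top-height instance (specialise the conclusion to `j := J`). [cite: Balaban1985UV3, (41)-(47) pp.266-267] -/
theorem topHeight_of_backwardStabilityAdmFR (h : Summit.QuantumFields.YangMills.Theses.BackwardLiouvilleRigidity.BackwardStabilityAdmFR) :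
    open MeasureTheory Filter Topology Literature.MathematicalPhysics.QuantumFieldTheory.Balaban1983to89 T3ContinuumYM3Torus T3NestedUnitLaws T3UnitLawDensityEML T4Continuum BalabanUVClass T3UnitScaleTilt in ∃ γ₁ : ℝ, 0 < γ₁ ∧ ∀ (F : T3Family) (γ : ℝ), 0 < γ → γ ≤ γ₁ → ∀ (b₀ p₀ κ : ℝ) (j₀ : ℕ) (prm : ℕ → ClassParams) (ω η : ℕ → ℝ), 0 < b₀ → 0 < p₀ → AdmissibleClassParams F γ b₀ p₀ prm → 0 < κ → (∀ j, 0 ≤ ω j ∧ 0 ≤ η j) → Summable η → Summable (fun i => ∑' k, η (k + i)) → Tendsto (fun j => (∑' k, η (k + j)) * ((1 + 2 * ((F.L : ℝ) ^ j / γ) * (Fintype.card (Plaq (F.P j) 0) : ℝ)) * (Fintype.card (PBond (F.P j) 0) : ℝ) ^ 2)) atTop (𝓝 0) → ∀ (μ μ' : ((j : ℕ) → MeasureTheory.Measure (GaugeField (F.P j) 0 ↥(Matrix.specialUnitaryGroup (Fin 2) ℂ)))) (ρ ρ' : ((j : ℕ) → GaugeField (F.P j) 0 ↥(Matrix.specialUnitaryGroup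 (Fin 2) ℂ) → ℝ)), (∀ j : ℕ, IsProbabilityMeasure (μ j) ∧ μ j = Measure.map (descend F ℰp j) (μ (j + 1))) → (∀ j : ℕ, IsProbabilityMeasure (μ' j) ∧ μ' j = Measure.map (descend F ℰp j) (μ' (j + 1))) → (∀ j : ℕ, j₀ ≤ j → ((∀ U, PlaqSmall (θBal F.L γ b₀ p₀ j) U → 0 < ρ j U ∧ 0 < ρ' j U) ∧ μ j = (fieldMeasure _ _ _).withDensity (fun U => ENNReal.ofReal (ρ j U)) ∧ μ' j = (fieldMeasure _ _ _).withDensity (fun U => ENNReal.ofReal (ρ' j U)) ∧ (∃ κ : ℝ, MemAtHeight F ℰp j (prm j) (fun U => Real.exp κ * ρ j U)) ∧ (∃ κ : ℝ, MemAtHeight F ℰp j (prm j) (fun U => Real.exp κ * ρ' j U)) ∧ (∀ (b b' : PBond (F.P j) 0) U V W Z, PlaqSmall (θBal F.L γ b₀ p₀ j) U → PlaqSmall (θBal F.L γ b₀ p₀ j) V → PlaqSmall (θBal F.L γ b₀ p₀ j) W → PlaqSmall (θBal F.L γ b₀ p₀ j) Z → (∀ e, e ≠ b → U e = V e) → (∀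 e, e ≠ b' → U e = W e) → (∀ e, e ≠ b' → V e = Z e) → (∀ e, e ≠ b → W e = Z e) → |(Real.log (ρ j U) - Real.log (ρ' j U)) - (Real.log (ρ j V) - Real.log (ρ' j V)) - ((Real.log (ρ j W) - Real.log (ρ' j W)) - (Real.log (ρ j Z) - Real.log (ρ' j Z)))| ≤ ω j * Real.exp (-(κ * (b.src.tdist b'.src : ℝ)))) ∧ μ j {U | ¬ PlaqSmall (θBal F.L γ b₀ p₀ j) U} ≤ ENNReal.ofReal (η j) ∧ μ' j {U | ¬ PlaqSmall (θBal F.L γ b₀ p₀ j) U} ≤ ENNReal.ofReal (η j) ∧ (ContinuousOn (ρ j) {U | PlaqSmall (θBal F.L γ b₀ p₀ j) U} ∧ ContinuousOn (ρ' j) {U | PlaqSmall (θBal F.L γ b₀ p₀ j) U}))) → ∃ (θ C w₀ : ℝ) (ε δ : ℕ → ℝ) (j₁ : ℕ), 0 < θ ∧ 0 ≤ C ∧ 0 < w₀ ∧ (∀ j, 0 ≤ ε j ∧ 0 ≤ δ j) ∧ Summable ε ∧ Summable δ ∧ Summable (fun i => ∑' k, δ (k + i)) ∧ Tendsto (fun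 j => (∑' k, δ (k + j)) * ((1 + 2 * ((F.L : ℝ) ^ j / γ) * (Fintype.card (Plaq (F.P j) 0) : ℝ)) * (Fintype.card (PBond (F.P j) 0) : ℝ) ^ 2)) atTop (𝓝 0) ∧ j₀ ≤ j₁ ∧ ∀ (J : ℕ), j₁ ≤ J → Real.exp (∑' k, ε k + 1) * (θ * ω J + (∑' k, δ (k + J))) ≤ w₀ → C * (Real.exp (∑' k, ε k + 1) * ((J : ℝ) * (θ * ω J) + (∑' i, ∑' k, δ (k + (i + J))))) ≤ 1 → ∀ (b : PBond (F.P J) 0) U V, PlaqSmall (θBal F.L γ b₀ p₀ J) U → PlaqSmall (θBal F.L γ b₀ p₀ J) V → (∀ e, e ≠ b → U e = V e) → |(Real.log (ρ J U) - Real.log (ρ' J U)) - (Real.log (ρ J V) - Real.log (ρ' J V))| ≤ Real.exp (∑' k, ε k + 1) * (θ * ω J + (∑' k, δ (k + J))) * (1 / θ + 2 * ((F.L : ℝ) ^ J / γ) * (Fintype.card (Plaq (F.P J) 0) : ℝ)) := by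
  obtain ⟨γ₁, hγ₁, h⟩ := h
  refine ⟨γ₁, hγ₁, ?_⟩
  intro F γ hγ hγ1 b₀ p₀ κ j₀ prm ω η hb₀ hp₀ hprm hκ hωη hη hηt hηf μ μ' ρ ρ' hμ hμ' hB
  obtain ⟨θ, C, w₀, ε, δ, j₁, hθ, hC, hw₀, hεδ, hε, hδ, hδt, hδf, hj, hmain⟩ :=
    h F γ hγ hγ1 b₀ p₀ κ j₀ prm ω η hb₀ hp₀ hprm hκ hωη hη hηt hηf μ μ' ρ ρ' hμ hμ' hB
  exact ⟨θ, C, w₀, ε, δ, j₁, hθ, hC, hw₀, hεδ, hε, hδ, hδt, hδf, hj, fun J hJ => hmain J J hJ le_rfl⟩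

/-- `BackwardStabilityAdmFR` implies its restriction to non-merging pairs (drop the inserted hypothesis). [cite: Balaban1985UV3, (41)-(47) pp.266-267] -/
theorem omega_ge_of_backwardStabilityAdmFR (h : Summit.QuantumFields.YangMills.Theses.BackwardLiouvilleRigidity.BackwardStabilityAdmFR) :
    open MeasureTheory Filter Topology Literature.MathematicalPhysics.QuantumFieldTheory.Balaban1983to89 T3ContinuumYM3Torus T3NestedUnitLaws T3UnitLawDensityEML T4Continuum BalabanUVClass T3UnitScaleTilt in ∃ γ₁ : ℝ, 0 < γ₁ ∧ ∀ (F : T3Family) (γ : ℝ), 0 < γ → γ ≤ γ₁ → ∀ (b₀ p₀ κ : ℝ) (j₀ : ℕ) (prm : ℕ → ClassParams) (ω η : ℕ → ℝ), 0 < b₀ → 0 < p₀ → AdmissibleClassParams F γ b₀ p₀ prm → 0 < κ → (∀ j, 0 ≤ ω j ∧ 0 ≤ η j) → (∃ m : ℝ, 0 < m ∧ ∀ j, m ≤ ω j) → Summable η → Summable (fun i => ∑' k, η (k + i)) → Tendsto (fun j => (∑' k, η (k + j)) * ((1 + 2 * ((F.L : ℝ) ^ j / γ) * (Fintype.card (Plaq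 (F.P j) 0) : ℝ)) * (Fintype.card (PBond (F.P j) 0) : ℝ) ^ 2)) atTop (𝓝 0) → ∀ (μ μ' : ((j : ℕ) → MeasureTheory.Measure (GaugeField (F.P j) 0 ↥(Matrix.specialUnitaryGroup (Fin 2) ℂ)))) (ρ ρ' : ((j : ℕ) → GaugeField (F.P j) 0 ↥(Matrix.specialUnitaryGroup (Fin 2) ℂ) → ℝ)), (∀ j : ℕ, IsProbabilityMeasure (μ j) ∧ μ j = Measure.map (descend F ℰp j) (μ (j + 1))) → (∀ j : ℕ, IsProbabilityMeasure (μ' j) ∧ μ' j = Measure.map (descend F ℰp j) (μ' (j + 1))) → (∀ j : ℕ, j₀ ≤ j → ((∀ U, PlaqSmall (θBal F.L γ b₀ p₀ j) U → 0 < ρ j U ∧ 0 < ρ' j U) ∧ μ j = (fieldMeasure _ _ _).withDensity (fun U => ENNReal.ofReal (ρ j U)) ∧ μ' j = (fieldMeasure _ _ _).withDensity (fun U => ENNReal.ofReal (ρ' j U)) ∧ (∃ κ : ℝ, MemAtHeight F ℰp j (prm j) (fun U => Real.exp κ * ρ j U)) ∧ (∃ κ : ℝ, MemAtHeight F ℰp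 j (prm j) (fun U => Real.exp κ * ρ' j U)) ∧ (∀ (b b' : PBond (F.P j) 0) U V W Z, PlaqSmall (θBal F.L γ b₀ p₀ j) U → PlaqSmall (θBal F.L γ b₀ p₀ j) V → PlaqSmall (θBal F.L γ b₀ p₀ j) W → PlaqSmall (θBal F.L γ b₀ p₀ j) Z → (∀ e, e ≠ b → U e = V e) → (∀ e, e ≠ b' → U e = W e) → (∀ e, e ≠ b' → V e = Z e) → (∀ e, e ≠ b → W e = Z e) → |(Real.log (ρ j U) - Real.log (ρ' j U)) - (Real.log (ρ j V) - Real.log (ρ' j V)) - ((Real.log (ρ j W) - Real.log (ρ' j W)) - (Real.log (ρ j Z) - Real.log (ρ' j Z)))| ≤ ω j * Real.exp (-(κ * (b.src.tdist b'.src : ℝ)))) ∧ μ j {U | ¬ PlaqSmall (θBal F.L γ b₀ p₀ j) U} ≤ ENNReal.ofReal (η j) ∧ μ' j {U | ¬ PlaqSmall (θBal F.L γ b₀ p₀ j) U} ≤ ENNReal.ofReal (η j) ∧ (ContinuousOn (ρ j) {U | PlaqSmall (θBal F.L γ b₀ p₀ j) U} ∧ ContinuousOn (ρ' j) {U | PlaqSmall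 (θBal F.L γ b₀ p₀ j) U}))) → ∃ (θ C w₀ : ℝ) (ε δ : ℕ → ℝ) (j₁ : ℕ), 0 < θ ∧ 0 ≤ C ∧ 0 < w₀ ∧ (∀ j, 0 ≤ ε j ∧ 0 ≤ δ j) ∧ Summable ε ∧ Summable δ ∧ Summable (fun i => ∑' k, δ (k + i)) ∧ Tendsto (fun j => (∑' k, δ (k + j)) * ((1 + 2 * ((F.L : ℝ) ^ j / γ) * (Fintype.card (Plaq (F.P j) 0) : ℝ)) * (Fintype.card (PBond (F.P j) 0) : ℝ) ^ 2)) atTop (𝓝 0) ∧ j₀ ≤ j₁ ∧ ∀ (j J : ℕ), j₁ ≤ j → j ≤ J → Real.exp (∑' k, ε k + 1) * (θ * ω J + (∑' k, δ (k + j))) ≤ w₀ → C * (Real.exp (∑' k, ε k + 1) * ((J : ℝ) * (θ * ω J) + (∑' i, ∑' k, δ (k + (i + j))))) ≤ 1 → ∀ (b : PBond (F.P j) 0) U V, PlaqSmall (θBal F.L γ b₀ p₀ j) U → PlaqSmall (θBal F.L γ b₀ p₀ j) V → (∀ e, e ≠ b → U e = V e) → |(Real.log (ρ j U) - Real.log (ρ'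 j U)) - (Real.log (ρ j V) - Real.log (ρ' j V))| ≤ Real.exp (∑' k, ε k + 1) * (θ * ω J + (∑' k, δ (k + j))) * (1 / θ + 2 * ((F.L : ℝ) ^ j / γ) * (Fintype.card (Plaq (F.P j) 0) : ℝ)) := by
  obtain ⟨γ₁, hγ₁, h⟩ := h
  refine ⟨γ₁, hγ₁, ?_⟩
  intro F γ hγ hγ1 b₀ p₀ κ j₀ prm ω η hb₀ hp₀ hprm hκ hωη _ hη hηt hηf μ μ' ρ ρ' hμ hμ' hB
  exact h F γ hγ hγ1 b₀ p₀ κ j₀ prm ω η hb₀ hp₀ hprm hκ hωη hη hηt hηf μ μ' ρ ρ' hμ hμ' hB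


/-! ## §5 (appended) Fast-merging pairs: a floor-class four-point rate makes the crux trivial -/

/-- **`BackwardStabilityAdmFR` RESTRICTED TO FAST-MERGING PAIRS HOLDS TRIVIALLY**: the crux's statement (route l.179) with THREE hypotheses on the
four-point rate inserted after `(∀ j, 0 ≤ ω j ∧ 0 ≤ η j) →` — `Summable ω`, `Summable (fun i => ∑' k, ω (k + i))` and the floor-class condition
`Tendsto (fun j => (∑' k, ω (k + j)) * ((1 + 2 * ((F.L : ℝ) ^ j / γ) * #Plaq_j) * #PBond_j ^ 2)) atTop (𝓝 0)` (i.e. `ω` ITSELF is an admissible large-field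
floor) — everything else VERBATIM incl. the full conclusion: take `δ := ω`, `θ := 1, C := 0, w₀ := 1, ε := 0, j₁ := j₀`; at any `j ≤ J` the degenerate rectangle
gives `osc_j ≤ ω_j ≤ ∑' k, ω (k + j)` (the `k = 0` term) `≤ e·(ω_J + ∑' k, ω (k + j))·(1 + 2β_j·#Plaq_j)`.  SCOPING TRICHOTOMY (with §2–§3): the crux is VACUOUS on
non-merging pairs (`inf ω > 0`), TRIVIAL on floor-class-merging pairs, and free on the diagonal `j = J`; its content is the backward propagation `j < J` for pairs
merging only along a subsequence ∕ slower than the floor class — the assembly's `liminf J·ω_J = 0` regime. [cite: Balaban1985UV3, (25) p.262, (41)-(47) pp.266-267] -/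
theorem backwardStabilityAdmFR_of_omega_floorClass : open MeasureTheory Filter Topology Literature.MathematicalPhysics.QuantumFieldTheory.Balaban1983to89 T3ContinuumYM3Torus T3NestedUnitLaws T3UnitLawDensityEML T4Continuum BalabanUVClass T3UnitScaleTilt in ∃ γ₁ : ℝ, 0 < γ₁ ∧ ∀ (F : T3Family) (γ : ℝ), 0 < γ → γ ≤ γ₁ → ∀ (b₀ p₀ κ : ℝ) (j₀ : ℕ) (prm : ℕ → ClassParams) (ω η : ℕ → ℝ), 0 < b₀ → 0 < p₀ → AdmissibleClassParams F γ b₀ p₀ prm → 0 < κ → (∀ j, 0 ≤ ω j ∧ 0 ≤ η j) → Summable ω → Summable (fun i => ∑' k, ω (k + i)) → Tendsto (fun j => (∑' k, ω (k + j)) * ((1 + 2 * ((F.L : ℝ) ^ j / γ) * (Fintype.card (Plaq (F.P j) 0) : ℝ)) * (Fintype.card (PBond (F.P j) 0) : ℝ) ^ 2)) atTop (𝓝 0) → Summable η → Summable (fun i => ∑' k, η (k + i)) → Tendsto (fun j => (∑' k, η (k + j)) * ((1 + 2 * ((F.L : ℝ) ^ j / γ) * (Fintype.card (Plaq (F.P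 j) 0) : ℝ)) * (Fintype.card (PBond (F.P j) 0) : ℝ) ^ 2)) atTop (𝓝 0) → ∀ (μ μ' : ((j : ℕ) → MeasureTheory.Measure (GaugeField (F.P j) 0 ↥(Matrix.specialUnitaryGroup (Fin 2) ℂ)))) (ρ ρ' : ((j : ℕ) → GaugeField (F.P j) 0 ↥(Matrix.specialUnitaryGroup (Fin 2) ℂ) → ℝ)), (∀ j : ℕ, IsProbabilityMeasure (μ j) ∧ μ j = Measure.map (descend F ℰp j) (μ (j + 1))) → (∀ j : ℕ, IsProbabilityMeasure (μ' j) ∧ μ' j = Measure.map (descend F ℰp j) (μ' (j + 1))) → (∀ j : ℕ, j₀ ≤ j → ((∀ U, PlaqSmall (θBal F.L γ b₀ p₀ j) U → 0 < ρ j U ∧ 0 < ρ' j U) ∧ μ j = (fieldMeasure _ _ _).withDensity (fun U => ENNReal.ofReal (ρ j U)) ∧ μ' j = (fieldMeasure _ _ _).withDensity (fun U => ENNReal.ofReal (ρ' j U)) ∧ (∃ κ : ℝ, MemAtHeight F ℰp j (prm j) (fun U => Real.exp κ * ρ j U)) ∧ (∃ κ : ℝ, MemAtHeight F ℰp j (prm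 j) (fun U => Real.exp κ * ρ' j U)) ∧ (∀ (b b' : PBond (F.P j) 0) U V W Z, PlaqSmall (θBal F.L γ b₀ p₀ j) U → PlaqSmall (θBal F.L γ b₀ p₀ j) V → PlaqSmall (θBal F.L γ b₀ p₀ j) W → PlaqSmall (θBal F.L γ b₀ p₀ j) Z → (∀ e, e ≠ b → U e = V e) → (∀ e, e ≠ b' → U e = W e) → (∀ e, e ≠ b' → V e = Z e) → (∀ e, e ≠ b → W e = Z e) → |(Real.log (ρ j U) - Real.log (ρ' j U)) - (Real.log (ρ j V) - Real.log (ρ' j V)) - ((Real.log (ρ j W) - Real.log (ρ' j W)) - (Real.log (ρ j Z) - Real.log (ρ' j Z)))| ≤ ω j * Real.exp (-(κ * (b.src.tdist b'.src : ℝ)))) ∧ μ j {U | ¬ PlaqSmall (θBal F.L γ b₀ p₀ j) U} ≤ ENNReal.ofReal (η j) ∧ μ' j {U | ¬ PlaqSmall (θBal F.L γ b₀ p₀ j) U} ≤ ENNReal.ofReal (η j) ∧ (ContinuousOn (ρ j) {U | PlaqSmall (θBal F.L γ b₀ p₀ j) U} ∧ ContinuousOn (ρ' j) {U | PlaqSmall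 (θBal F.L γ b₀ p₀ j) U}))) → ∃ (θ C w₀ : ℝ) (ε δ : ℕ → ℝ) (j₁ : ℕ), 0 < θ ∧ 0 ≤ C ∧ 0 < w₀ ∧ (∀ j, 0 ≤ ε j ∧ 0 ≤ δ j) ∧ Summable ε ∧ Summable δ ∧ Summable (fun i => ∑' k, δ (k + i)) ∧ Tendsto (fun j => (∑' k, δ (k + j)) * ((1 + 2 * ((F.L : ℝ) ^ j / γ) * (Fintype.card (Plaq (F.P j) 0) : ℝ)) * (Fintype.card (PBond (F.P j) 0) : ℝ) ^ 2)) atTop (𝓝 0) ∧ j₀ ≤ j₁ ∧ ∀ (j J : ℕ), j₁ ≤ j → j ≤ J → Real.exp (∑' k, ε k + 1) * (θ * ω J + (∑' k, δ (k + j))) ≤ w₀ → C * (Real.exp (∑' k, ε k + 1) * ((J : ℝ) * (θ * ω J) + (∑' i, ∑' k, δ (k + (i + j))))) ≤ 1 → ∀ (b : PBond (F.P j) 0) U V, PlaqSmall (θBal F.L γ b₀ p₀ j) U → PlaqSmall (θBal F.L γ b₀ p₀ j) V → (∀ e, e ≠ b → U e = V e) → |(Real.log (ρ j U) - Real.log (ρ'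 j U)) - (Real.log (ρ j V) - Real.log (ρ' j V))| ≤ Real.exp (∑' k, ε k + 1) * (θ * ω J + (∑' k, δ (k + j))) * (1 / θ + 2 * ((F.L : ℝ) ^ j / γ) * (Fintype.card (Plaq (F.P j) 0) : ℝ)) := by
  refine ⟨1, one_pos, ?_⟩
  intro F γ hγ hγ1 b₀ p₀ κ j₀ prm ω η hb₀ hp₀ hprm hκ hωη hωs hωt hωf hη hηt hηf μ μ' ρ ρ' hμ hμ' hB
  refine ⟨1, 0, 1, fun _ => 0, ω, j₀, one_pos, le_rfl, one_pos, fun j => ⟨le_rfl, (hωη j).1⟩, summable_zero, hωs, hωt, hωf, le_rfl, ?_⟩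
  intro j J hj _ _ _ b U V hU hV hUV
  obtain ⟨-, -, -, -, -, h4, -, -, -⟩ := hB j hj
  have hosc : |(Real.log (ρ j U) - Real.log (ρ' j U)) - (Real.log (ρ j V) - Real.log (ρ' j V))| ≤ ω j :=
    abs_sub_le_of_fourPoint (D := fun X => Real.log (ρ j X) - Real.log (ρ' j X)) (S := PlaqSmall (θBal F.L γ b₀ p₀ j))
      (h4 := fun b b' U V W Z hU hV hW hZ h1 h2 h3 h4' => h4 b b' U V W Z hU hV hW hZ h1 h2 h3 h4') b U V hU hV hUV
  refine hosc.trans ?_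
  -- `ω_j ≤ Σ_{k ≥ j} ω_k` (the `k = 0` term of a non-negative summable series)
  have hωj : ω j ≤ ∑' k, ω (k + j) := by
    have hs : Summable fun k => ω (k + j) := (summable_nat_add_iff j).mpr hωs
    have h0 := hs.sum_le_tsum {0} (fun k _ => (hωη (k + j)).1)
    simpa using h0
  have hT0 : 0 ≤ ∑' k, ω (k + j) := tsum_nonneg fun k => (hωη (k + j)).1
  have hωJ : 0 ≤ ω J := (hωη J).1
  have hL : (0 : ℝ) < F.L := by exact_mod_cast lt_trans zero_lt_one F.hL.2
  have hβ : 0 ≤ 2 * ((F.L : ℝ) ^ j / γ) * (Fintype.card (Plaq (F.P j) 0) : ℝ) :=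
    mul_nonneg (mul_nonneg zero_le_two (div_nonneg (pow_nonneg hL.le j) hγ.le)) (Nat.cast_nonneg _)
  have he : (1 : ℝ) ≤ Real.exp (∑' k : ℕ, (fun _ : ℕ => (0 : ℝ)) k + 1) := by simp
  have h1 : ∑' k, ω (k + j) ≤ (∑' k, ω (k + j)) * (1 / 1 + 2 * ((F.L : ℝ) ^ j / γ) * (Fintype.card (Plaq (F.P j) 0) : ℝ)) :=
    le_mul_of_one_le_right hT0 (by linarith)
  calc ω j ≤ ∑' k, ω (k + j) := hωj
    _ ≤ (∑' k, ω (k + j)) * (1 / 1 + 2 * ((F.L : ℝ) ^ j / γ) * (Fintype.card (Plaq (F.P j) 0) : ℝ)) := h1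
    _ = 1 * (0 + ∑' k, ω (k + j)) * (1 / 1 + 2 * ((F.L : ℝ) ^ j / γ) * (Fintype.card (Plaq (F.P j) 0) : ℝ)) := by ring
    _ ≤ Real.exp (∑' k : ℕ, (fun _ : ℕ => (0 : ℝ)) k + 1) * (1 * ω J + ∑' k, ω (k + j)) *
          (1 / 1 + 2 * ((F.L : ℝ) ^ j / γ) * (Fintype.card (Plaq (F.P j) 0) : ℝ)) := by
        gcongr
        · linarith

/-- `BackwardStabilityAdmFR` implies its restriction to fast-merging pairs (drop the three inserted hypotheses). [cite: Balaban1985UV3, (41)-(47) pp.266-267] -/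
theorem omega_floorClass_of_backwardStabilityAdmFR
    (h : Summit.QuantumFields.YangMills.Theses.BackwardLiouvilleRigidity.BackwardStabilityAdmFR) :
    open MeasureTheory Filter Topology Literature.MathematicalPhysics.QuantumFieldTheory.Balaban1983to89 T3ContinuumYM3Torus T3NestedUnitLaws T3UnitLawDensityEML T4Continuum BalabanUVClass T3UnitScaleTilt in ∃ γ₁ : ℝ, 0 < γ₁ ∧ ∀ (F : T3Family) (γ : ℝ), 0 < γ → γ ≤ γ₁ → ∀ (b₀ p₀ κ : ℝ) (j₀ : ℕ) (prm : ℕ → ClassParams) (ω η : ℕ → ℝ), 0 < b₀ → 0 < p₀ → AdmissibleClassParams F γ b₀ p₀ prm → 0 < κ → (∀ j, 0 ≤ ω j ∧ 0 ≤ η j) → Summable ω → Summable (fun i => ∑' k, ω (k + i)) → Tendsto (fun j => (∑' k, ω (k + j)) * ((1 + 2 * ((F.L : ℝ) ^ j / γ) * (Fintype.card (Plaq (F.P j) 0) : ℝ)) * (Fintype.card (PBond (F.P j) 0) : ℝ) ^ 2)) atTop (𝓝 0) → Summable η → Summable (fun i => ∑' k, η (k + i)) → Tendsto (fun j => (∑'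 k, η (k + j)) * ((1 + 2 * ((F.L : ℝ) ^ j / γ) * (Fintype.card (Plaq (F.P j) 0) : ℝ)) * (Fintype.card (PBond (F.P j) 0) : ℝ) ^ 2)) atTop (𝓝 0) → ∀ (μ μ' : ((j : ℕ) → MeasureTheory.Measure (GaugeField (F.P j) 0 ↥(Matrix.specialUnitaryGroup (Fin 2) ℂ)))) (ρ ρ' : ((j : ℕ) → GaugeField (F.P j) 0 ↥(Matrix.specialUnitaryGroup (Fin 2) ℂ) → ℝ)), (∀ j : ℕ, IsProbabilityMeasure (μ j) ∧ μ j = Measure.map (descend F ℰp j) (μ (j + 1))) → (∀ j : ℕ, IsProbabilityMeasure (μ' j) ∧ μ' j = Measure.map (descend F ℰp j) (μ' (j + 1))) → (∀ j : ℕ, j₀ ≤ j → ((∀ U, PlaqSmall (θBal F.L γ b₀ p₀ j) U → 0 < ρ j U ∧ 0 < ρ' j U) ∧ μ j = (fieldMeasure _ _ _).withDensity (fun U => ENNReal.ofReal (ρ j U)) ∧ μ' j = (fieldMeasure _ _ _).withDensity (fun U => ENNReal.ofReal (ρ' j U)) ∧ (∃ κ : ℝ, MemAtHeight F ℰp j (prm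 j) (fun U => Real.exp κ * ρ j U)) ∧ (∃ κ : ℝ, MemAtHeight F ℰp j (prm j) (fun U => Real.exp κ * ρ' j U)) ∧ (∀ (b b' : PBond (F.P j) 0) U V W Z, PlaqSmall (θBal F.L γ b₀ p₀ j) U → PlaqSmall (θBal F.L γ b₀ p₀ j) V → PlaqSmall (θBal F.L γ b₀ p₀ j) W → PlaqSmall (θBal F.L γ b₀ p₀ j) Z → (∀ e, e ≠ b → U e = V e) → (∀ e, e ≠ b' → U e = W e) → (∀ e, e ≠ b' → V e = Z e) → (∀ e, e ≠ b → W e = Z e) → |(Real.log (ρ j U) - Real.log (ρ' j U)) - (Real.log (ρ j V) - Real.log (ρ' j V)) - ((Real.log (ρ j W) - Real.log (ρ' j W)) - (Real.log (ρ j Z) - Real.log (ρ' j Z)))| ≤ ω j * Real.exp (-(κ * (b.src.tdist b'.src : ℝ)))) ∧ μ j {U | ¬ PlaqSmall (θBal F.L γ b₀ p₀ j) U} ≤ ENNReal.ofReal (η j) ∧ μ' j {U | ¬ PlaqSmall (θBal F.L γ b₀ p₀ j) U} ≤ ENNReal.ofReal (η j) ∧ (ContinuousOn (ρ j) {U | PlaqSmall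 (θBal F.L γ b₀ p₀ j) U} ∧ ContinuousOn (ρ' j) {U | PlaqSmall (θBal F.L γ b₀ p₀ j) U}))) → ∃ (θ C w₀ : ℝ) (ε δ : ℕ → ℝ) (j₁ : ℕ), 0 < θ ∧ 0 ≤ C ∧ 0 < w₀ ∧ (∀ j, 0 ≤ ε j ∧ 0 ≤ δ j) ∧ Summable ε ∧ Summable δ ∧ Summable (fun i => ∑' k, δ (k + i)) ∧ Tendsto (fun j => (∑' k, δ (k + j)) * ((1 + 2 * ((F.L : ℝ) ^ j / γ) * (Fintype.card (Plaq (F.P j) 0) : ℝ)) * (Fintype.card (PBond (F.P j) 0) : ℝ) ^ 2)) atTop (𝓝 0) ∧ j₀ ≤ j₁ ∧ ∀ (j J : ℕ), j₁ ≤ j → j ≤ J → Real.exp (∑' k, ε k + 1) * (θ * ω J + (∑' k, δ (k + j))) ≤ w₀ → C * (Real.exp (∑' k, ε k + 1) * ((J : ℝ) * (θ * ω J) + (∑' i, ∑' k, δ (k + (i + j))))) ≤ 1 → ∀ (b : PBond (F.P j) 0) U V, PlaqSmall (θBal F.L γ b₀ p₀ j) U → PlaqSmall (θBal F.L γ b₀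 p₀ j) V → (∀ e, e ≠ b → U e = V e) → |(Real.log (ρ j U) - Real.log (ρ' j U)) - (Real.log (ρ j V) - Real.log (ρ' j V))| ≤ Real.exp (∑' k, ε k + 1) * (θ * ω J + (∑' k, δ (k + j))) * (1 / θ + 2 * ((F.L : ℝ) ^ j / γ) * (Fintype.card (Plaq (F.P j) 0) : ℝ)) := by
  obtain ⟨γ₁, hγ₁, h⟩ := h
  refine ⟨γ₁, hγ₁, ?_⟩
  intro F γ hγ hγ1 b₀ p₀ κ j₀ prm ω η hb₀ hp₀ hprm hκ hωη _ _ _ hη hηt hηf μ μ' ρ ρ' hμ hμ' hB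
  exact h F γ hγ hγ1 b₀ p₀ κ j₀ prm ω η hb₀ hp₀ hprm hκ hωη hη hηt hηf μ μ' ρ ρ' hμ hμ' hB

end Summit.QuantumFields.YangMills.Theorems.AdmFRTopHeight
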